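import Literature.Topology.FourManifolds.SliceKnotsFoxMilnorHNNForms
import Literature.Topology.FourManifolds.SliceKnotsProofs
import Literature.Topology.FourManifolds.SliceRibbonTopSliceProofs
import HarnessLib

/-!
# Fox–Milnor (`Δ(t) ≐ f(t) f(t⁻¹)` for slice knots): the geometric half as a notion and ONE named fact, and the assembly of BOTH Fox–Milnor facts

Topic `Literature/Topology/FourManifolds`. Fact-decomposition record (librarian, fact-decompose,
2026-08-16) for the named fact
`Literature.Topology.FourManifolds.exists_eq_mul_invert_of_isTopologicallySlice` (`SliceKnots.lean`,
spc4.S26: R. H. Fox, J. W. Milnor, *Singularities of 2-spheres in 4-space and cobordism of knots*,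
Osaka J. Math. 3 (1966), Thm. 2 — an Alexander polynomial of a topologically slice knot is
`u · f(t) · f(t⁻¹)`), an XL fact that ran to the prover budget cap, and — through the tree's
`exists_eq_mul_invert_of_isTopologicallySlice.isSmoothlySlice` with the proved
`Knot.IsSmoothlySlice.isTopologicallySlice_holds` — for its smooth twin
`exists_eq_mul_invert_of_isSmoothlySlice` as well.

The proof programme of the fact seat (`SliceKnotsFoxMilnorProofs`, `…Metabolizer`, `…MetabolizerForms`,
`…HNN`, `…HNNForms`, `AlexanderModuleHNN`, `KnotGroupMulEquivProofs`, …) PROVES the whole ALGEBRAIC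
half of the proof in print (Kauffman, *On Knots*, Ch. VIII, Thm. 8.2–8.3; Livingston, *A survey of
classical knot concordance*, Thm. 2.6, §3.3, §6; Rolfsen §8.C): if the knot group is given as an HNN
extension `HNN(G; A, φ)` over a Seifert surface with Seifert matrix `V` read off in a dual basis of
`Gᵃᵇ`, and `V` has a RATIONAL metabolizer, then every Alexander polynomial is `u f f̄`
(`Knot.exists_eq_mul_invert_of_hnn_rat_presentation`), and it reduces both named facts to ONE
explicit hypothesis, the GEOMETRIC half (`exists_eq_mul_invert_of_isTopologicallySlice_of_hnn_rat_presentation`):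
every topologically slice knot admits such data. That hypothesis bundles three classical theorems
about one Seifert surface `F` — (i) Seifert–van Kampen for the knot complement split along the
bicollared (minimal genus, hence `π₁`-injective) `F`; (ii) Alexander/linking duality
`H₁(S³ ∖ F) ≅ Hom(H₁ F, ℤ)` identifying the push-off coordinates with the Seifert matrix;
(iii) "slice ⇒ algebraically slice": for a flat slice disc `D`, `F ∪ D` bounds a `3`-manifold
`R ⊆ B⁴` (topological transversality in the locally flat case, Freedman–Quinn 9.5) and
`ker(H₁(F; ℚ) → H₁(R; ℚ))` is a half-dimensional isotropic subspace of the Seifert form — which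
cannot be separated into independent CLOSED statements without a geometric Seifert-form notion the
tree does not have (the metabolizer must belong to the SAME matrix `V`). Following the
notion-plus-consequence shape of the decomposition rules, this file therefore introduces

* the NOTION `Knot.IsHNNSeifertMatrix K V` — "`V` is a Seifert matrix of `K` in Seifert–van Kampen
  form": the data (i)–(ii) exist with matrix `V` (a definition with body; nothing to discharge);
* ONE named fact `exists_ratMetabolic_hnnSeifertMatrix_of_isTopologicallySlice` — the geometric
  half: a topologically slice knot has a Seifert matrix in Seifert–van Kampen form with a rational
  metabolizer (Livingston Thm. 2.6 with §6; Kauffman Lemma 8.1, Thm. 8.2; Rolfsen §5.C, §8.C;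
  Freedman–Quinn §9.5 for transversality);

and PROVES: `Knot.IsHNNSeifertMatrix.exists_eq_mul_invert_of_ratMetabolizer` (the algebraic half
over the notion), the assembly `exists_eq_mul_invert_of_isTopologicallySlice_holds_of` (child ⟹ the
topological fact) and `exists_eq_mul_invert_of_isSmoothlySlice_of_ratMetabolic` (child ⟹ the smooth
fact, through `Knot.IsSmoothlySlice.isTopologicallySlice_holds`; the canonical
`exists_eq_mul_invert_of_isSmoothlySlice_holds_of : topological fact → smooth fact` is
`SliceKnotsFoxMilnorSmoothOfTopological.lean`). No statement of another file is modified.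

Remark (not vendored, to keep the debt at one fact): by (i)–(ii) EVERY knot has a Seifert matrix in
Seifert–van Kampen form (`∀ K, ∃ n V, K.IsHNNSeifertMatrix V`; Seifert 1934, Rolfsen §5.C, §8.C,
Burde–Zieschang Ch. 4); only the metabolizer needs sliceness.

## References

* [FoxMilnor1966] R. H. Fox, J. W. Milnor, Osaka J. Math. 3 (1966), 257–267, Thm. 2.
* [Livingston2005] C. Livingston, *A survey of classical knot concordance*, Handbook of Knot Theory
  (2005), Def. 2.5, Thm. 2.6, §3.3, §6.
* [Kauffman1987] L. H. Kauffman, *On Knots*, Ann. of Math. Studies 115 (1987), Ch. VII; Ch. VIII,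
  Lemma 8.1, Thm. 8.2–8.3.
* [Rolfsen1976] D. Rolfsen, *Knots and Links* (1976), §5.C, §8.C.
* [FreedmanQuinnPMS1990] M. H. Freedman, F. Quinn, *Topology of 4-manifolds* (1990), §9.5
  (topological transversality), §9.3.
-/

open scoped LaurentPolynomial
open Function Set Matrix LaurentPolynomial HNNExtension Multiplicative Module

noncomputable section

namespace Literature.Topology.FourManifolds

namespace Knot

/-- **`V` is a Seifert matrix of the knot `K` in Seifert–van Kampen form** (the notion behind the
geometric half of Fox–Milnor). There are: a base point `x`, a group `G` with subgroups `A`, `B`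
and an isomorphism `φ : A ≃* B`, an isomorphism `Φ` of the knot group `π₁(S³ ∖ K, x)` with the HNN
extension `HNN(G; A, B, φ)`, an isomorphism `e : π₁ᵃᵇ ≃* ℤ` sending the class of the stable letter
to `1`, a `ℤ`-basis `b` of `Gᵃᵇ` indexed by `Fin n` with lifts `gⱼ ∈ G`, and generators
`a₁, …, aₙ` of `A`, such that the coordinates in `b` of `āᵢ` form the `i`-th COLUMN of `V` and those
of `φ(aᵢ)‾` the `i`-th ROW. Geometric meaning (Rolfsen §5.C, §8.C; Kauffman Ch. VII; Burde–Zieschang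
Ch. 4): for a `π₁`-injective (e.g. minimal genus) Seifert surface `F` of genus `g`, `n = 2g`,
`G = π₁(S³ ∖ F)`, `A`, `B` the images of `π₁(F)` under the two push-offs, `Φ` the Seifert–van Kampen
isomorphism (meridian ↦ stable letter), `b` the basis of `H₁(S³ ∖ F) ≅ Hom(H₁ F, ℤ)` dual to
generators of `H₁(F)` under linking, and `V` the Seifert matrix `Vᵢⱼ = lk(aᵢ, aⱼ⁺)`. Exactly the
data consumed by `Knot.exists_eq_mul_invert_of_hnn_presentation` /
`…_of_hnn_rat_presentation` (`SliceKnotsFoxMilnorHNN`, `…HNNForms`). A definition with body;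
nothing to discharge. [cite: Rolfsen1976, §5.C and §8.C] [cite: Kauffman1987, Ch. VII] -/
def IsHNNSeifertMatrix (K : Knot) {n : ℕ} (V : Matrix (Fin n) (Fin n) ℤ) : Prop :=
  ∃ (x : K.complement) (G : Type) (_ : Group G) (A B : Subgroup G) (φ : A ≃* B)
    (Φ : K.group x ≃* HNNExtension G A B φ) (e : Abelianization (K.group x) ≃* Multiplicative ℤ)
    (b : Module.Basis (Fin n) ℤ (Additive (Abelianization G))) (g : Fin n → G) (a : Fin n → A),
    e (Abelianization.of (Φ.symm t)) = ofAdd 1 ∧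
    (∀ j, Additive.ofMul (Abelianization.of (g j)) = b j) ∧
    Subgroup.closure (Set.range a) = ⊤ ∧
    (∀ i j, b.repr (Additive.ofMul (Abelianization.of (a i : G))) j = V j i) ∧
    (∀ i j, b.repr (Additive.ofMul (Abelianization.of (φ (a i) : G))) j = V i j)

/-- **The algebraic half of Fox–Milnor over the notion** (PROVED): if `V` is a Seifert matrix of
`K` in Seifert–van Kampen form and `V` has a rational metabolizer — a subspace `W ≤ ℚⁿ` with
`2 · dim W = n` on which `vᵀ V w` vanishes — then every Alexander polynomial `Δ` of `K`
(`Knot.IsAlexanderPolynomial`) is `u · f · f(t⁻¹)` for some `f ∈ ℤ[t, t⁻¹]` and a unit `u`. This is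
`Knot.exists_eq_mul_invert_of_hnn_rat_presentation` (`SliceKnotsFoxMilnorHNNForms`: the Seifert
matrix presents the Alexander module, Rolfsen §8.C, and `det (V − tVᵀ) = u f f̄` for metabolic `V`,
Kauffman Thm. 8.3 (ii) / Livingston §3.3) with the data unpacked.
[cite: FoxMilnor1966, Thm. 2] [cite: Kauffman1987, Ch. VIII Lemma 8.1, Thm. 8.2–8.3]
[cite: Rolfsen1976, §8.C] -/
theorem IsHNNSeifertMatrix.exists_eq_mul_invert_of_ratMetabolizer {K : Knot} {n : ℕ}
    {V : Matrix (Fin n) (Fin n) ℤ} (hV : K.IsHNNSeifertMatrix V)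
    (W : Submodule ℚ (Fin n → ℚ)) (hW : 2 * Module.finrank ℚ W = n)
    (hVW : ∀ v ∈ W, ∀ w ∈ W, v ⬝ᵥ (V.map ((↑) : ℤ → ℚ) *ᵥ w) = 0)
    {Δ : ℤ[T;T⁻¹]} (hΔ : K.IsAlexanderPolynomial Δ) :
    ∃ (f : ℤ[T;T⁻¹]) (u : ℤ[T;T⁻¹]ˣ), Δ = ↑u * f * LaurentPolynomial.invert f := by
  obtain ⟨x, G, _, A, B, φ, Φ, e, b, g, a, he, hg, ha, hVp, hVm⟩ := hV
  exact K.exists_eq_mul_invert_of_hnn_rat_presentation x Φ e he b g hg a ha V hVp hVm W hW hVW hΔ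

end Knot

/-! ### The geometric half, named -/

/-- **The geometric half of Fox–Milnor's theorem: a topologically slice knot has a RATIONALLY
METABOLIC Seifert matrix in Seifert–van Kampen form.** For every knot `K ⊆ S³` bounding a flat
(locally flat, with a product neighbourhood) disc in `B⁴` (`Knot.IsTopologicallySlice`) there are
`n`, an integer matrix `V` which is a Seifert matrix of `K` in Seifert–van Kampen form
(`Knot.IsHNNSeifertMatrix K V`) and a subspace `W ≤ ℚⁿ` with `2 · dim W = n` on which the rational
Seifert form `vᵀ V w` vanishes. In print: take a minimal genus Seifert surface `F` of `K` (Seifert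
1934; its two push-offs are `π₁`-injective), so that the knot group is the HNN extension of
`π₁(S³ ∖ F)` along `π₁(F)` (Seifert–van Kampen) and `H₁(S³ ∖ F) ≅ Hom(H₁ F, ℤ)` by linking, the
push-off coordinates being the Seifert matrix `V` (Rolfsen §5.C, §8.C; Kauffman Ch. VII); if `K`
bounds a slice disc `D`, then `F ∪ D` bounds a compact `3`-manifold `R ⊆ B⁴` and "half lives, half
dies" — `ker(H₁(F; ℚ) → H₁(R; ℚ))` has dimension `g` and the Seifert form vanishes on it — so `V` is
(rationally) metabolic (Kauffman Ch. VIII, Lemma 8.1 and Thm. 8.2: "if `K` is a slice knot then its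
Seifert pairing is metabolic"; Livingston Def. 2.5, Thm. 2.6, and §6 for the topological locally
flat category, where `R` comes from topological transversality, Freedman–Quinn §9.5). This is
verbatim the explicit hypothesis of
`exists_eq_mul_invert_of_isTopologicallySlice_of_hnn_rat_presentation` (`SliceKnotsFoxMilnorHNNForms`)
with the HNN data abbreviated by the notion `Knot.IsHNNSeifertMatrix`; everything downstream of it
is proved. [cite: Livingston2005, Def. 2.5, Thm. 2.6 and §6] [cite: Kauffman1987, Ch. VIII Lemma 8.1, Thm. 8.2; Ch. VII]
[cite: Rolfsen1976, §5.C and §8.C] [cite: FreedmanQuinnPMS1990, §9.5] -/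
def exists_ratMetabolic_hnnSeifertMatrix_of_isTopologicallySlice : Prop :=
  ∀ K : Knot, K.IsTopologicallySlice →
    ∃ (n : ℕ) (V : Matrix (Fin n) (Fin n) ℤ) (W : Submodule ℚ (Fin n → ℚ)),
      K.IsHNNSeifertMatrix V ∧ 2 * Module.finrank ℚ W = n ∧
      ∀ v ∈ W, ∀ w ∈ W, v ⬝ᵥ (V.map ((↑) : ℤ → ℚ) *ᵥ w) = 0

/-! ### The assembly of both Fox–Milnor facts -/

/-- **spc4.S26, topological form (`exists_eq_mul_invert_of_isTopologicallySlice`), from its one named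
leaf** (fact-decomposition glue, canonical name): the geometric half (this file) and the proved
algebraic half (`Knot.IsHNNSeifertMatrix.exists_eq_mul_invert_of_ratMetabolizer`).
[cite: FoxMilnor1966, Thm. 2] [cite: Livingston2005, Thm. 2.6, §3.3, §6] -/
theorem exists_eq_mul_invert_of_isTopologicallySlice_holds_of
    (h : exists_ratMetabolic_hnnSeifertMatrix_of_isTopologicallySlice) :
    exists_eq_mul_invert_of_isTopologicallySlice := by
  intro K hK Δ hΔ
  obtain ⟨n, V, W, hV, hW, hVW⟩ := h K hK
  exact hV.exists_eq_mul_invert_of_ratMetabolizer W hW hVW hΔ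

/-- **spc4.S26, smooth form (`exists_eq_mul_invert_of_isSmoothlySlice`), from the same leaf**: a
smoothly slice knot is topologically slice (the tree's PROVED
`Knot.IsSmoothlySlice.isTopologicallySlice_holds`, `SliceRibbonTopSliceProofs`), and the topological
fact applies (`exists_eq_mul_invert_of_isTopologicallySlice.isSmoothlySlice`, `SliceKnotsProofs`).
[cite: FoxMilnor1966, Thm. 2] [cite: Kauffman1987, Ch. VIII Thm. 8.2–8.3] -/
theorem exists_eq_mul_invert_of_isSmoothlySlice_of_ratMetabolic
    (h : exists_ratMetabolic_hnnSeifertMatrix_of_isTopologicallySlice) :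
    exists_eq_mul_invert_of_isSmoothlySlice :=
  exists_eq_mul_invert_of_isTopologicallySlice.isSmoothlySlice
    (exists_eq_mul_invert_of_isTopologicallySlice_holds_of h)
    Knot.IsSmoothlySlice.isTopologicallySlice_holds

end Literature.Topology.FourManifolds

end
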